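import Summits.ValiantsHypothesis.ValiantsHypothesis.Theses.DepthWindow
import Summits.ValiantsHypothesis.ValiantsHypothesis.Theorems.DepthWindowHalf
import Literature.Computability.AlgebraicComplexity.HomogeneousCircuits
import HarnessLib

/-!
# Route `DepthWindow`, g5 — the NEWTON-HALVING split of the crux `PerHardLog3`

The open interval of the product-depth dial — slope `[1/2, 1]·log₂log₂log₂ n` for the permanent —
is, read through the Limaye–Srinivasan–Tavenas / Bhargav–Dutta–Saxena pipeline, EXACTLY the cost
of homogenisation: the set-multilinear relative-rank measure reaches product-depth
`Γ ≈ log_φ log₂ d ≈ 1.44·log₂log₂ d` (BDS24 Thm 1.4, `μ(Γ) = 1/(F(Γ) − 1)`), the conversion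
homogeneous → set-multilinear keeps the product-depth (LST Lemma 12, size `× d!`), and the whole
loss is the conversion general → homogeneous, which DOUBLES the product-depth `Δ ↦ 2Δ`
(LST Lemma 11; BDS24 Remark 1.5: "the difference between μ(2Δ) and μ(Δ) is due to the doubling
of product-depth during this conversion"). The doubling is Newton's identities: the homogeneous
components of a product gate `∏ₖ (1 + yₖ)` are elementary symmetric polynomials of the `yₖ`,
written as polynomials in the power sums `∑ₖ yₖ^ρ` — one product layer for the powers, one for
the products of power sums.

This file proves the GLUE of the split
`PerHardLog3 ⟸ HomPlus ∧ HomImmHardLog3`: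

* `HomPlus` ("Hom⁺", depth-efficient homogenisation over `ℂ`): every circuit computing a
  homogeneous degree-`d` polynomial can be homogenised with product-depth `+ O(1)` (not `× 2`)
  at size cost `poly(s) · 2^{O(d)}` — OPEN (LST Lemma 11 gives `2Δ`; Nisan–Wigderson 1996 shows
  `+ 0` is impossible already at `Δ = 1`);
* `HomImmHardLog3`: HOMOGENEOUS circuits of product-depth `log₂log₂log₂ m + c` for
  `IMM_{m, ⌊√log₂ m⌋}` are superpolynomial — a theorem in print (BDS24 Thm 1.4 + LST Lemma 12:
  homogeneous reach `1.44·log₂log₂ d − O(1) > log₂log₂log₂ m + c`), not yet in the tree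
  (the tree's measure `LSTWord.relRank_aeval_eval_le` has `μ_Δ = 1/(2^{2Δ+1} − 1)`).

The proof is the VNP-completeness transport of `perHardBelowHalf` (per ← IMM by p-projection,
`isVNPComplete_perPoly_holds`, wires → gates `exists_size_le_edgeSize`), evaluated along the
towers `m = 2^(2^(2^Y))` (`log3_tower`, `log3_le_of_le_tower_pow`), followed by `HomPlus` at the
IMM level (degree `⌊√log₂ m⌋`, so `2^{O(d)} ≤ m^{O(1)}`), contradicting `HomImmHardLog3`.
[cite: LimayeSrinivasanTavenas2025, Lemma 11, Lemma 12] [cite: BhargavDuttaSaxena2024, Thm. 1.4, Rem. 1.5]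
-/

-- layout Summits/ValiantsHypothesis/ValiantsHypothesis forces the duplicated namespace component
set_option linter.dupNamespace false

namespace Summit.ValiantsHypothesis.ValiantsHypothesis.Theorems.DepthWindow

open MvPolynomial Real Literature.Computability.AlgebraicComplexity ArithCircuit
open Literature.Computability.AlgebraicComplexity.LSTWord
open Summit.ValiantsHypothesis.ValiantsHypothesis.Theses.DepthWindow

noncomputable section

/-- `2 ^ (a ⌊√⌊log₂ m⌋⌋) ≤ m ^ a + a`: the `2^{O(d)}` homogenisation overhead is polynomial at
degree `d = ⌊√log₂ m⌋`. [folklore] -/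
theorem two_pow_mul_sqrt_log_le (a m : ℕ) : 2 ^ (a * Nat.sqrt (Nat.log 2 m)) ≤ m ^ a + a := by
  rcases Nat.eq_zero_or_pos m with rfl | hm
  · rcases a with _ | a <;> simp
  · calc 2 ^ (a * Nat.sqrt (Nat.log 2 m)) ≤ 2 ^ (a * Nat.log 2 m) :=
          Nat.pow_le_pow_right (by norm_num) (Nat.mul_le_mul_left a (Nat.sqrt_le_self _))
      _ = (2 ^ Nat.log 2 m) ^ a := by rw [mul_comm, pow_mul]
      _ ≤ m ^ a := Nat.pow_le_pow_left (Nat.pow_log_le_self 2 hm.ne') a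
      _ ≤ m ^ a + a := Nat.le_add_right _ _

/-- **Glue of the Newton-halving split** (g5): depth-efficient homogenisation (`HomPlus`) and the
print-level homogeneous hardness of `IMM` at product-depth `log₂log₂log₂ m + O(1)`
(`HomImmHardLog3`) together give the crux `PerHardLog3`.
[cite: LimayeSrinivasanTavenas2025, Lemma 11, Lemma 12] [cite: BhargavDuttaSaxena2024, Thm. 1.4, Rem. 1.5] -/
theorem perHardLog3_of_homSplit (hHom : HomPlus) (hHard : HomImmHardLog3) :
    PerHardLog3 := by
  classical
  rintro ⟨c, hc⟩
  -- the degree function `d(m) = ⌊√⌊log₂ m⌋⌋ ≤ m`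
  let dd : ℕ → ℕ := fun m => Nat.sqrt (Nat.log 2 m)
  have hdd_le : ∀ m, dd m ≤ m := fun m => (Nat.sqrt_le_self _).trans (Nat.log_le_self 2 m)
  -- the IMM family and its renaming to `Fin (v m)` variables
  let v : ℕ → ℕ := fun m => Fintype.card (Fin (dd m) × Fin m × Fin m)
  let e : ∀ m, (Fin (dd m) × Fin m × Fin m) ≃ Fin (v m) := fun m => Fintype.equivFin _
  let G : ∀ m, MvPolynomial (Fin (dd m) × Fin m × Fin m) ℂ := fun m => immPoly m (dd m) ℂ
  let G' : ∀ m, MvPolynomial (Fin (v m)) ℂ := fun m => renameEquiv ℂ (e m) (G m)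
  have hv : ∀ m, Fintype.card (Fin (dd m) × Fin m × Fin m) ≤ m ^ 3 + 3 := fun m => by
    simp only [Fintype.card_prod, Fintype.card_fin]
    calc dd m * (m * m) ≤ m * (m * m) := Nat.mul_le_mul_right _ (hdd_le m)
      _ = m ^ 3 := by ring
      _ ≤ m ^ 3 + 3 := Nat.le_add_right _ _
  have hG : IsVPFamily G := by
    refine ⟨⟨⟨3, fun m => hv m⟩, ⟨1, fun m => ?_⟩⟩, ⟨6, fun m => ?_⟩⟩
    · show (immPoly m (dd m) ℂ).totalDegree ≤ m ^ 1 + 1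
      refine ((immPoly_isHomogeneous_holds (k := ℂ) m (dd m)).totalDegree_le).trans ?_
      rw [pow_one]; exact (hdd_le m).trans (Nat.le_succ m)
    · show complexity (immPoly m (dd m) ℂ) ≤ m ^ 6 + 6
      calc complexity (immPoly m (dd m) ℂ) ≤ m + 2 * m ^ 3 * dd m := complexity_immPoly_le ℂ m (dd m)
        _ ≤ m ^ 1 + 2 * (m ^ 1) ^ 3 * m := by
            rw [pow_one]; exact Nat.add_le_add_left (Nat.mul_le_mul_left _ (hdd_le m)) _
        _ ≤ m ^ (3 * 1 + 3) + (3 * 1 + 3) := imm_cost_le 1 m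
        _ = m ^ 6 + 6 := by norm_num
  have hG' : IsVPFamily G' := (isVPFamily_renameEquiv_iff e G).2 hG
  have hG'N : IsVNPFamily G' := IsVPFamily.isVNPFamily_holds' hG'
  -- VNP-completeness of the permanent over `ℂ`: `G'` is a p-projection of `per`
  obtain ⟨t, ht, hproj⟩ := (isVNPComplete_perPoly_holds ℂ ringChar_complex_ne_two).2 v G' hG'N
  obtain ⟨b, hb⟩ : IsPBounded fun m => t m ^ c + c :=
    IsPBounded.comp_holds (s := fun N => N ^ c + c) ⟨c, fun N => le_rfl⟩ ht
  obtain ⟨a, ha⟩ := ht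
  -- few-gate circuits for `G m = IMM_{m, dd m}`, of product-depth `≤ ⌊log₂log₂log₂ (t m)⌋ + 1`
  have key : ∀ m, ∃ D : ArithCircuit ℂ (Fin (dd m) × Fin m × Fin m),
      D.Computes (G m) ∧ D.productDepth ≤ Nat.log 2 (Nat.log 2 (Nat.log 2 (t m))) + 1 ∧
        D.size ≤ m ^ b + b := by
    intro m
    obtain ⟨C, hCc, hCd, hCe⟩ := hc (t m)
    obtain ⟨D', hD'c, hD'd, hD'e, -⟩ := exists_circuit_of_isProjection (hproj m) C hCc
    have hGm : MvPolynomial.rename (e m).symm (G' m) = G m := by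
      show MvPolynomial.rename (e m).symm (renameEquiv ℂ (e m) (G m)) = G m
      rw [renameEquiv_apply, rename_rename, (e m).symm_comp_self, rename_id_apply]
    obtain ⟨D, hDe, hDd, hDw, hDs⟩ := exists_size_le_edgeSize (D'.rename (e m).symm)
    refine ⟨D, ?_, ?_, ?_⟩
    · rw [Computes, hDe, ← hGm]; exact hD'c.rename (e m).symm
    · exact hDd.trans ((DepthThreeChasm.productDepth_rename _ _).le.trans (hD'd.trans hCd))
    · calc D.size ≤ D.edgeSize := hDs
        _ ≤ (D'.rename (e m).symm).edgeSize := hDw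
        _ = D'.edgeSize := DepthThreeChasm.edgeSize_rename _ _
        _ ≤ C.edgeSize := hD'e
        _ ≤ t m ^ c + c := hCe
        _ ≤ m ^ b + b := hb m
  -- homogenise at the IMM level: product-depth `+ c₀`, size still polynomial in `m`
  obtain ⟨c₀, a₁, hhom⟩ := hHom
  obtain ⟨b', hb'⟩ : IsPBounded fun m => (m ^ b + b + (m ^ 3 + 3) + 2) ^ a₁ * (m ^ a₁ + a₁) :=
    IsPBounded.mul_holds
      (IsPBounded.pow_holds (IsPBounded.add_holds (IsPBounded.add_holds
        ⟨b, fun m => le_rfl⟩ ⟨3, fun m => le_rfl⟩) (IsPBounded.const 2)) a₁)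
      ⟨a₁, fun m => le_rfl⟩
  have keyH : ∀ m, ∃ D : ArithCircuit ℂ (Fin (dd m) × Fin m × Fin m),
      (∀ g ∈ ArithCircuit.gateValues D.gates, ∃ e : ℕ, g.IsHomogeneous e) ∧ D.Computes (G m) ∧
        D.productDepth ≤ Nat.log 2 (Nat.log 2 (Nat.log 2 (t m))) + 1 + c₀ ∧
        D.size ≤ m ^ b' + b' := by
    intro m
    obtain ⟨D, hDc, hDd, hDs⟩ := key m
    obtain ⟨D', hD'c, hD'h, hD'd, hD's⟩ :=
      hhom _ (dd m) (G m) (immPoly_isHomogeneous_holds (k := ℂ) m (dd m)) D hDc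
    refine ⟨D', hD'h, hD'c, hD'd.trans (Nat.add_le_add_right hDd _), hD's.trans ((?_ : _ ≤ _).trans (hb' m))⟩
    exact Nat.mul_le_mul (Nat.pow_le_pow_left (by have := hv m; omega) _)
      (two_pow_mul_sqrt_log_le a₁ m)
  -- the homogeneous hardness at exponent `c' = c₀ + b' + 2`, from `m₀` on
  obtain ⟨m₀, hm₀⟩ := hHard (c₀ + b' + 2)
  -- evaluate at the tower `m = 2^(2^(2^Y))` with `Y ≥ m₀` and `a + 1 ≤ 2 ^ Y`
  obtain ⟨Y, hYa, hYm⟩ : ∃ Y : ℕ, a + 1 ≤ 2 ^ Y ∧ m₀ ≤ Y := by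
    refine ⟨a + m₀ + 1, ?_, by omega⟩
    have : a + m₀ + 1 < 2 ^ (a + m₀ + 1) := Nat.lt_two_pow_self
    omega
  set m : ℕ := 2 ^ (2 ^ (2 ^ Y)) with hm
  have hYm' : m₀ ≤ m := by
    have h1 : Y < 2 ^ Y := Nat.lt_two_pow_self
    have h2 : 2 ^ Y < 2 ^ (2 ^ Y) := Nat.pow_lt_pow_right (by norm_num) h1
    have h3 : 2 ^ (2 ^ Y) < 2 ^ (2 ^ (2 ^ Y)) := Nat.pow_lt_pow_right (by norm_num) h2
    omega
  have hm2 : 2 ≤ m := by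
    have : 1 ≤ 2 ^ (2 ^ Y) := Nat.one_le_two_pow
    calc 2 = 2 ^ 1 := by norm_num
      _ ≤ 2 ^ (2 ^ (2 ^ Y)) := Nat.pow_le_pow_right (by norm_num) this
  have hL3m : Nat.log 2 (Nat.log 2 (Nat.log 2 m)) = Y := log3_tower Y
  have hL3t : Nat.log 2 (Nat.log 2 (Nat.log 2 (t m))) ≤ Y + 1 :=
    log3_le_of_le_tower_pow Y a (t m) hYa (ha m)
  obtain ⟨D, hDh, hDc, hDd, hDs⟩ := keyH m
  have hdepth : D.productDepth ≤ Nat.log 2 (Nat.log 2 (Nat.log 2 m)) + (c₀ + b' + 2) := by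
    rw [hL3m]; omega
  have hlt := hm₀ m hYm' D hDh hDc hdepth
  -- `m ^ (c₀ + b' + 2) + (c₀ + b' + 2) < D.size ≤ m ^ b' + b'`: absurd
  have hmono : m ^ b' + b' ≤ m ^ (c₀ + b' + 2) + (c₀ + b' + 2) :=
    Nat.add_le_add (Nat.pow_le_pow_right (by omega) (by omega)) (by omega)
  omega

/-- The homogeneity clause of `HomPlus` / `HomImmHardLog3` is `ArithCircuit.IsHomogeneousCircuit`
spelt out (the route file does not import `HomogeneousCircuits.lean`). [folklore] -/
theorem isHomogeneousCircuit_iff_gateValues {σ : Type*} (D : ArithCircuit ℂ σ) :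
    D.IsHomogeneousCircuit ↔ ∀ g ∈ ArithCircuit.gateValues D.gates, ∃ e : ℕ, g.IsHomogeneous e :=
  Iff.rfl

/-- **Item `PerHardLog3OfNewtonSplit`** (the glue of the Newton-halving split, gen 1 of
`PerHardLog3`): `HomPlus → HomImmHardLog3 → PerHardLog3`.
[cite: LimayeSrinivasanTavenas2025, Lemma 11, Lemma 12] [cite: BhargavDuttaSaxena2024, Thm. 1.4, Rem. 1.5] -/
theorem perHardLog3OfNewtonSplit_holds : PerHardLog3OfNewtonSplit :=
  fun hHom hHard => perHardLog3_of_homSplit hHom hHard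

end

end Summit.ValiantsHypothesis.ValiantsHypothesis.Theorems.DepthWindow
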